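import Summits.ABC.IUTFork.Cor312PilotKummerCompat
import Summits.ABC.IUTFork.Cor312PilotIdelesPrCapstone
import Summits.ABC.IUTFork.Cor312ProvenanceGenuine
import Summits.ABC.IUTFork.Thm311Real3
import Summits.ABC.ABC.Theorems.IUTThetaPilotThetaPartIIULineCapstone
import HarnessLib

/-!
# Branch C certificate, INTAKE companion 3: the HULL-LEVEL line S_H AT THE GENUINE REAL SETTING OF THE DATUM, unbundled —
# no index-bijection binder, FREE column data, and the S-layer CONE binder split to the hull REGIME residue

C scoreboard, companion Shrink3 (`abc_of_SH_shrink3`): S_H 1 · PIN 1 (q-pin) · FACT 0 · CONE 1 (`hreg`) · READ 1 (Θ-side, one-sided) · SIDE 6 = 10 (explicit) / EFFECTIVE 21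
EFFECTIVE Prop hypotheses: explicit 11 + transitive structure fields 10 = 21 [FACT-LIST 1 · SUMMIT-PROP 0 · LITERATURE-PROP 0 · CORE 6 · COMPOUND 3 · other 0 · nested structures 0] (v3: fields of project-structure DATA binders, depth ≤ 4, a nested structure type is expanded once per binder)
(tool line = abc-iut-w5-d035's `HypAuditScan.lean` v3 VERBATIM; «explicit 11» = the 10 `Prop` binders + the instance-class binder `[∀ P l T, NumberField (M P l T)]`;
the 10 structure fields = X 4 · lat 2 · sig 2 · split 1 · qData 1, well-formedness fields of the genuine containers.)
Reference (tree `AbcOfSGenuine.lean` v3 `abc_of_S_v3`, abc-iut-C-cert-2 p430884): apex explicit 2 (S_H-bundle `H` · CONE `hvol`) / EFFECTIVE 2;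
per datum inside the bundle (`cor312Of_of_SH_genuine`): S_H 1 · PIN 1 (+ idele side 5) · FACT 0 · CONE 0 · READ 4 (`hI`, `hX`, `hplaces`,
`hΘ`) = 11 named.

PROOF-ONLY companion (no `def`, no new `Prop`) by the INTAKE seat abc-iut-C-cert-3 (CLAIM on STATUS 2026-08-26T07:36:40Z, first refusal to
abc-iut-C-cert-2). After C-lead ruling C-R10 the LIVE line of branch C is the HULL-LEVEL form
S_H := `Cor312Vol.PilotKummerCompatHull S P ρ qK` (abc-iut-w5-d068, `Cor312PilotKummerCompat.lean` l. 107: «in every packet the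
`ρ`-region of the q-pilot's Kummer datum lies in the holomorphic hull of the union of the possible images of the Θ-pilot» —
[IUTchIII] Cor. 3.12 Step (xi-d) p. 183 l. 2–8 «followed by formation of the holomorphic hull»; under the q-pin it IS abc-iut-c312-1's
(xi-f) `Licence`), because the identification-level S = `PilotKummerIndRelated` is KERNEL-REFUTED at honestly-scaled genuine data
(abc-iut-C-cert-1 `PinnedHonestReal.not_pilotKummerIndRelated_settingPrVolSharp_of_pinned` p430714; at Shrink2's data
`Shrink2.not_S_of_pins_of_realising` p430998), whereas S_H is implied by, not contradicting, the printed inequality. v3 (p430884)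
states the S_H line at abc-iut-c312-7's genuine setting inside an `∃`-bundle. THIS FILE is the same line as an INTAKE companion in
the shape of `AbcOfSShrink2` (p430322), with three differences, each a strict weakening of the hypothesis list BY LANDED THEOREMS:

(a) NO `hplaces` (the index bijection `𝕍(F)… ≃ V̲` of abc-iut-c312-8's `IsSettingOf`, a genuine restriction on `(D, X)`): the q-side
    is read by abc-iut-c312-7 `negLogQ_settingPrVolSharp_eq_neg_absLogq` (p424856) ∘ abc-iut-c312-8
    `Cor312Prov.negAbsLogQ_eq_neg_absLogq_of_isVolumeInputOf` (p413743) directly, as in Shrink2 — `IsSettingOf` is never formed;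
(b) FREE column data (`frobAdm frobLogvol frobΨ frobMmod unitImage ballImage thetaDiv`): the hull-level line does not consume
    [IUTchIII] Thm. 3.11 at all (`statement_of_pilotKummerCompatHull` needs `BridgeHyps` + q-pin + S_H), so NO strictification and no
    (ii)(b) — the CAVEAT of Shrink1/2 does not arise;
(c) the S-layer CONE binder is SPLIT (abc-iut-C-cert-1 2026-08-26T07:29:26Z, strictly weaker and named): `hvol` ((ii′) `HullVolumeAtDatum`
    for ALL data) ↦ **`hreg`** = the hull-volume estimate with `B_III` ONLY for the NON-slot-constant data, via abc-iut-c312-8's (U)-line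
    capstone `Summit.ABC.ABC.Theorems.ThetaPartII.ABC_of_cor312_of_hullRegime` (p428563: slot-constant data — in particular `d_mod = 1`
    — PROVED inside, `genEllTwo_holds` discharged by name) — the certificate's S-layer input is exactly RISK ¶7's open residue.
And, as in Shrink2, an UNBUNDLED apex indexed by `(P, l, T)` so that the hypaudit tool counts the per-datum binders directly (C-R6).

REMAINING per datum (explicit `Prop` binders): [S_H] `hSH` · [PIN] `hQPin` (the q-pin (pq′) alone) · [READ] `hΘ` (ONE-SIDED:
the setting's verbatim `−|log(Θ)| ≤` the datum's defined `−|log(Θ)|` — OPEN, owners c312-7 / S7 / S3) · [SIDE] `hX` (`X` is the pilot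
data OF `T.D`, inhabited by `Cor312Prov.pilotDataOfF`), `htq0 htq1 ht0 ht1` (ideles non-zero, units off `S`), `htq` (q-ideles REALISE
`P_q`; satisfiable iff `2l ∣ ord_v(q_v)` on `S` — RECORDED SEAM of Shrink2, owners c312-7/c312-8) · [CONE] `hreg` at the (P,l) level.
DISCHARGED BY NAME on this line: `BridgeHyps` (incl. `ThetaFinite`, p424856), the q-number reading (p424856 ∘ p413743), [GenEll] Thm 2.1
at Σ = {2} (`genEllTwo_holds`), the slot-constant hull volumes (p428563), (P7) (`ThetaPartII.stub_thetaData` inside the capstone).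
NON-VACUITY at honest data: S_H is a CONSEQUENCE of the printed inequality's hull reading, not refuted by `not_S_of_pins_of_realising`
(that theorem refutes the identification-level S only); a by-construction witness of `hQPin ∧ hSH` at realising ideles is C-R10c's
wanted item (abc-iut-C-cert-1 / aud), not claimed here.

HONEST FRAMING: this campaign LOCATES / CONDITIONALLY VERIFIES. Nothing here asserts that abc is proved or refuted, or that
[IUTchIII] Cor. 3.12 / Thm. 3.11 holds or fails, or takes a side on any author (Mochizuki / Scholze–Stix / Joshi /
Dupuy–Hilado); «`ABC` follows from S_H + the listed hypotheses AS TYPED, at these data», nothing more; S_H is an assumption label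
(it IS the disputed (xi-f) inclusion at the genuine setting); typed ≠ proved; instantiated ≠ endorsed. [claim: Mochizuki2012, status: disputed]
[cite: DupuyHilado2025, §3.3–§3.4] [cite: Mochizuki2012, IUTchIII Cor. 3.12 Step (xi-d) p. 183; IUTchIV Thm. 1.10 p. 23]
-/

noncomputable section

open Set Function NumberField IsDedekindDomain

namespace Summit.ABC.IUTFork.Conditional

open Thm311 Thm311.Real Cor312 Cor312Vol Cor312Prov Literature.IUT.LogThetaLattice Literature.IUT.LogVolume
  Literature.IUT.HodgeTheaters Literature.IUT.LogVolume.ThetaData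

/-! ## §1. One datum: `I.Cor312Of` at the genuine real setting of `D` from S_H + the q-pin + Θ-side identification + side conditions -/

section PerDatum

variable {F K Fbar : Type} [Field F] [NumberField F] [Field K] [NumberField K] [Algebra F K] [Field Fbar]
  [Algebra F Fbar] [Algebra K Fbar] {E : WeierstrassCurve F} [E.IsElliptic] {l : ℕ} {Pb : BadPlacePredicates K}
  (D : InitialThetaData F K Fbar E l Pb) {I : ThetaVolumeInput (fieldOfModuli E) K}
  (X : PilotData F) (M : Type) [Field M] [NumberField M]
  (archPk : ∀ (j : (thetaIndex X).Label) (vQ : (thetaIndex X).VQ), Set ((logShellsDH X (analyticLogv F)).Packet j vQ))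
  (archSub : ∀ (j : (thetaIndex X).Label) (v : (thetaIndex X).V),
    Set ((logShellsDH X (analyticLogv F)).Packet j ((thetaIndex X).over v)))
  (Ψ : ℤ → ∀ v : (thetaIndex X).V, v ∈ (thetaIndex X).Vbad → Set ((logShellsDH X (analyticLogv F)).StarPacket v))
  (act : ℤ → ∀ v : (thetaIndex X).V, v ∈ (thetaIndex X).Vbad →
    (logShellsDH X (analyticLogv F)).StarPacket v → Module.End ℚ ((logShellsDH X (analyticLogv F)).StarPacket v))
  (Mmod : ℤ → ∀ j : (thetaIndex X).LabelStar, Set ((logShellsDH X (analyticLogv F)).GlobalPacket j.1))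
  (region : ℤ → ∀ j : (thetaIndex X).LabelStar, FinDivisor M → ∀ vQ : (thetaIndex X).VQ,
    Set ((logShellsDH X (analyticLogv F)).Packet j.1 vQ))
  (frobAdm : ℤ → ℤ → ∀ (j : (thetaIndex X).Label) (vQ : (thetaIndex X).VQ),
    Set ((logShellsDH X (analyticLogv F)).Packet j vQ) → Prop)
  (frobLogvol : ℤ → ℤ → ∀ (j : (thetaIndex X).Label) (vQ : (thetaIndex X).VQ),
    Set ((logShellsDH X (analyticLogv F)).Packet j vQ) → ℝ)
  (frobΨ : ℤ → ℤ → ∀ v : (thetaIndex X).V, v ∈ (thetaIndex X).Vbad → Set ((logShellsDH X (analyticLogv F)).StarPacket v))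
  (frobMmod : ℤ → ℤ → ∀ j : (thetaIndex X).LabelStar, Set ((logShellsDH X (analyticLogv F)).GlobalPacket j.1))
  (unitImage : ℤ → ℤ → ℕ → ∀ (j : (thetaIndex X).Label) (vQ : (thetaIndex X).VQ),
    Set ((logShellsDH X (analyticLogv F)).Packet j vQ))
  (ballImage : ℤ → ℤ → ∀ (j : (thetaIndex X).Label) (vQ : (thetaIndex X).VQ),
    Set ((logShellsDH X (analyticLogv F)).Packet j vQ))
  (thetaDiv : ℤ → ℤ → LgpDivisor M (thetaIndex X).lstar)
  (n : ℤ) {HT : Type} {LogLink : HT → HT → Type} {IsFull : ∀ {s t : HT}, LogLink s t → Prop}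
  (lat : LGPGaussianLogThetaLattice LogLink IsFull)
  {Frd : Type} {IsoF : Frd → Frd → Type} {Ob : Frd → Type} {realify : Frd → Frd} {Strip : Type}
  {IsoS : Strip → Strip → Type} {Mv : ∀ v : (thetaIndex X).V, v ∈ (thetaIndex X).Vbad → Type}
  [∀ v h, Monoid (Mv v h)]
  (sig : GlobalLGPFrobenioidSignature (thetaIndex X).lstar (thetaIndex X).V (· ∈ (thetaIndex X).Vbad)
    Frd IsoF Ob realify Strip IsoS Mv)
  (split : SplittingMonoids Mv) {ObΔ : Type} {N : ∀ v : (thetaIndex X).V, v ∈ (thetaIndex X).Vbad → Type}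
  [∀ v h, Monoid (N v h)] (qData : QPilotData ObΔ N)
  (t : ∀ (pp : Nat.Primes) (_ : Fin X.lstar) (x : (thetaIndex X).Fibre (.inr pp)),
    haveI : Fact (pp : ℕ).Prime := ⟨pp.2⟩; kOf X pp.1 x)
  (tq : ∀ (pp : Nat.Primes) (x : (thetaIndex X).Fibre (.inr pp)), haveI : Fact (pp : ℕ).Prime := ⟨pp.2⟩; kOf X pp.1 x)
  (ρ : (∀ v : (thetaIndex X).V, v ∈ (thetaIndex X).Vbad → Set ((logShellsDH X (analyticLogv F)).StarPacket v)) →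
    ∀ (j : (thetaIndex X).Label) (vQ : (thetaIndex X).VQ), Set ((logShellsDH X (analyticLogv F)).Packet j vQ))
  (qK : ∀ v : (thetaIndex X).V, v ∈ (thetaIndex X).Vbad → Set ((logShellsDH X (analyticLogv F)).StarPacket v))

/-- **One datum, genuine real setting, HULL-LEVEL line: `I.Cor312Of` FROM S_H (`PilotKummerCompatHull`), the q-pin, the one-sided
Θ-side identification and the named side conditions** — columns FREE, no index bijection. Route, by name: c312-7
`bridgeHyps_settingPrVolSharp_of_ideles` (p424856) + w5-d068 `statement_of_pilotKummerCompatHull` ⟹ the verbatim `Statement`; q-side: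
c312-7 `negLogQ_settingPrVolSharp_eq_neg_absLogq` + c312-8 `negAbsLogQ_eq_neg_absLogq_of_isVolumeInputOf`; Θ-side: `hΘ`. «`I.Cor312Of`
follows from S_H + these hypotheses as typed, at these data» — no side taken. [claim: Mochizuki2012, status: disputed] -/
theorem Shrink3.cor312Of_of_SH (hI : ThetaData.IsVolumeInputOf D I) (hX : Cor312Prov.IsPilotDataOf D X)
    (htq0 : ∀ pp x, tq pp x ≠ 0)
    (htq1 : ∀ (pp : Nat.Primes) (x : (thetaIndex X).Fibre (.inr pp)),
      haveI : Fact (pp : ℕ).Prime := ⟨pp.2⟩; placeOf X pp.1 x ∉ X.S → ‖tq pp x‖ = 1)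
    (ht0 : ∀ pp i x, t pp i x ≠ 0)
    (ht1 : ∀ (pp : Nat.Primes) (i : Fin X.lstar) (x : (thetaIndex X).Fibre (.inr pp)),
      haveI : Fact (pp : ℕ).Prime := ⟨pp.2⟩; placeOf X pp.1 x ∉ X.S → ‖t pp i x‖ = 1)
    (htq : ∀ (pp : Nat.Primes) (x : (thetaIndex X).Fibre (.inr pp)),
      haveI : Fact (pp : ℕ).Prime := ⟨pp.2⟩
      Real.log ‖tq pp x‖ = -(X.qPilot (placeOf X pp.1 x)) * logNorm F (placeOf X pp.1 x) /
        localDegree F (placeOf X pp.1 x))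
    (hSH : Cor312Vol.PilotKummerCompatHull
      (LatticeSituation.ofShells (logShellsDH X (analyticLogv F)) M archPk archSub
        (summandPiecesPr X (logvAnalytic_analyticLogv (F := F))).Adm
        (summandPiecesPr X (logvAnalytic_analyticLogv (F := F))).logvol Ψ act Mmod region frobAdm frobLogvol frobΨ
        frobMmod unitImage ballImage thetaDiv)
      (settingPrVolSharp X (logvAnalytic_analyticLogv (F := F)) M archPk archSub Ψ act Mmod region n lat sig split qData
        tq t htq0 htq1) ρ qK)
    (hQPin : Cor312Vol.QPinned
      (LatticeSituation.ofShells (logShellsDH X (analyticLogv F)) M archPk archSub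
        (summandPiecesPr X (logvAnalytic_analyticLogv (F := F))).Adm
        (summandPiecesPr X (logvAnalytic_analyticLogv (F := F))).logvol Ψ act Mmod region frobAdm frobLogvol frobΨ
        frobMmod unitImage ballImage thetaDiv)
      (settingPrVolSharp X (logvAnalytic_analyticLogv (F := F)) M archPk archSub Ψ act Mmod region n lat sig split qData
        tq t htq0 htq1) ρ qK)
    (hΘ : (settingPrVolSharp X (logvAnalytic_analyticLogv (F := F)) M archPk archSub Ψ act Mmod region n lat sig split qData
        tq t htq0 htq1).negLogTheta ≤
      ((I.negLogTheta : ℝ) : WithTop ℝ)) :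
    I.Cor312Of := by
  -- Step 1: the verbatim Statement at the genuine setting on the HULL-LEVEL line — hBridge := p424856; no Theorem 3.11 input at all
  have hst :
      (settingPrVolSharp X (logvAnalytic_analyticLogv (F := F)) M archPk archSub Ψ act Mmod region n lat sig split qData
        tq t htq0 htq1).Statement :=
    Cor312Vol.statement_of_pilotKummerCompatHull
      (LatticeSituation.ofShells (logShellsDH X (analyticLogv F)) M archPk archSub
        (summandPiecesPr X (logvAnalytic_analyticLogv (F := F))).Adm
        (summandPiecesPr X (logvAnalytic_analyticLogv (F := F))).logvol Ψ act Mmod region frobAdm frobLogvol frobΨ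
        frobMmod unitImage ballImage thetaDiv)
      (settingPrVolSharp X (logvAnalytic_analyticLogv (F := F)) M archPk archSub Ψ act Mmod region n lat sig split qData
        tq t htq0 htq1) ρ qK
      (bridgeHyps_settingPrVolSharp_of_ideles X (logvAnalytic_analyticLogv (F := F)) M archPk archSub Ψ act Mmod region n lat
        sig split qData t tq ht0 ht1 htq0 htq1)
      hQPin hSH
  -- Step 2: the q-side by provenance (no `IsSettingOf`, hence no index-bijection binder)
  have hq := negLogQ_settingPrVolSharp_eq_neg_absLogq X (logvAnalytic_analyticLogv (F := F)) M archPk archSub Ψ act Mmod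
    region n lat sig split qData t tq hX htq0 htq1 htq
  obtain ⟨-, hle⟩ := hst
  rw [hq] at hle
  -- Step 3: the Θ-side by the one-sided identification `hΘ`
  show I.negAbsLogQ ≤ I.negLogTheta
  rw [Cor312Prov.negAbsLogQ_eq_neg_absLogq_of_isVolumeInputOf D hI]
  exact WithTop.coe_le_coe.mp (hle.trans hΘ)

end PerDatum

/-! ## §2. The apex, unbundled: S_H at the genuine setting of EVERY datum + the hull REGIME residue ⟹ `ABC` -/

section Family

open Literature.NumberTheory.DiophantineGeometry.GenEll Summit.ABC.ABC.Theorems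

/-- **`abc_of_SH_shrink3` (branch C, HULL-LEVEL line AT THE GENUINE REAL SETTING OF EACH DATUM, unbundled; per datum explicit
S_H 1 · PIN 1 · FACT 0 · READ 1 · SIDE 6, plus the (P,l)-level CONE binder `hreg`).** `ABC` from, per `λ`-line point `P`, prime `l`
and genuine Θ-volume datum `T : Cor22.ThetaVolumeDatumAt P l`: DATA = pilot data `X P l T` over `T.F`, the context binders of
abc-iut-c312-7's print-normalised real setting with FREE column data, Θ-ideles and q-ideles, PR-1's `ρ`, `qK`; HYPOTHESES = [SIDE] `hX`,
`htq0 htq1 ht0 ht1`, `htq` · [S_H] `hSH` · [PIN] `hQPin` · [READ] `hΘ` (one-sided) · [CONE] `hreg` = the hull-volume estimate with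
`B_III(P,l)` for the NON-slot-constant data only (abc-iut-c312-8 `ABC_of_cor312_of_hullRegime`, p428563; verbatim binder). Proof:
§1 at `T.D`, `T.I`, `T.isVolumeInputOf` gives `Cor22.Cor312AtDatum P l` at every admissible `(P, l)`; then the (U)-line capstone.
«`ABC` follows from S_H + these hypotheses as typed, at these data» — no side taken on [IUTchIII] Cor. 3.12; typed ≠ proved;
instantiated ≠ endorsed. [claim: Mochizuki2012, status: disputed] -/
theorem abc_of_SH_shrink3
    -- DATA, per datum: pilot data over `T.F`, the context binders of the genuine real setting (logs FIXED: analytic), ideles, ρ, qK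
    (X : ∀ (P : NFPoint) (l : ℕ) (T : Cor22.ThetaVolumeDatumAt P l), @PilotData T.F T.instFieldF T.instNumberFieldF)
    (M : ∀ (P : NFPoint) (l : ℕ) (T : Cor22.ThetaVolumeDatumAt P l), Type) [∀ P l T, Field (M P l T)] [∀ P l T, NumberField (M P l T)]
    (archPk : ∀ (P : NFPoint) (l : ℕ) (T : Cor22.ThetaVolumeDatumAt P l), letI := T.instFieldF; letI := T.instNumberFieldF;
      ∀ (j : (thetaIndex (X P l T)).Label) (vQ : (thetaIndex (X P l T)).VQ), Set ((logShellsDH (X P l T) (analyticLogv T.F)).Packet j vQ))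
    (archSub : ∀ (P : NFPoint) (l : ℕ) (T : Cor22.ThetaVolumeDatumAt P l), letI := T.instFieldF; letI := T.instNumberFieldF;
      ∀ (j : (thetaIndex (X P l T)).Label) (v : (thetaIndex (X P l T)).V), Set ((logShellsDH (X P l T) (analyticLogv T.F)).Packet j ((thetaIndex (X P l T)).over v)))
    (Ψ : ∀ (P : NFPoint) (l : ℕ) (T : Cor22.ThetaVolumeDatumAt P l), letI := T.instFieldF; letI := T.instNumberFieldF;
      ℤ → ∀ v : (thetaIndex (X P l T)).V, v ∈ (thetaIndex (X P l T)).Vbad → Set ((logShellsDH (X P l T) (analyticLogv T.F)).StarPacket v))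
    (act : ∀ (P : NFPoint) (l : ℕ) (T : Cor22.ThetaVolumeDatumAt P l), letI := T.instFieldF; letI := T.instNumberFieldF;
      ℤ → ∀ v : (thetaIndex (X P l T)).V, v ∈ (thetaIndex (X P l T)).Vbad → (logShellsDH (X P l T) (analyticLogv T.F)).StarPacket v → Module.End ℚ ((logShellsDH (X P l T) (analyticLogv T.F)).StarPacket v))
    (Mmod : ∀ (P : NFPoint) (l : ℕ) (T : Cor22.ThetaVolumeDatumAt P l), letI := T.instFieldF; letI := T.instNumberFieldF;
      ℤ → ∀ j : (thetaIndex (X P l T)).LabelStar, Set ((logShellsDH (X P l T) (analyticLogv T.F)).GlobalPacket j.1))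
    (region : ∀ (P : NFPoint) (l : ℕ) (T : Cor22.ThetaVolumeDatumAt P l), letI := T.instFieldF; letI := T.instNumberFieldF;
      ℤ → ∀ j : (thetaIndex (X P l T)).LabelStar, FinDivisor (M P l T) → ∀ vQ : (thetaIndex (X P l T)).VQ, Set ((logShellsDH (X P l T) (analyticLogv T.F)).Packet j.1 vQ))
    (frobAdm : ∀ (P : NFPoint) (l : ℕ) (T : Cor22.ThetaVolumeDatumAt P l), letI := T.instFieldF; letI := T.instNumberFieldF;
      ℤ → ℤ → ∀ (j : (thetaIndex (X P l T)).Label) (vQ : (thetaIndex (X P l T)).VQ), Set ((logShellsDH (X P l T) (analyticLogv T.F)).Packet j vQ) → Prop)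
    (frobLogvol : ∀ (P : NFPoint) (l : ℕ) (T : Cor22.ThetaVolumeDatumAt P l), letI := T.instFieldF; letI := T.instNumberFieldF;
      ℤ → ℤ → ∀ (j : (thetaIndex (X P l T)).Label) (vQ : (thetaIndex (X P l T)).VQ), Set ((logShellsDH (X P l T) (analyticLogv T.F)).Packet j vQ) → ℝ)
    (frobΨ : ∀ (P : NFPoint) (l : ℕ) (T : Cor22.ThetaVolumeDatumAt P l), letI := T.instFieldF; letI := T.instNumberFieldF;
      ℤ → ℤ → ∀ v : (thetaIndex (X P l T)).V, v ∈ (thetaIndex (X P l T)).Vbad → Set ((logShellsDH (X P l T) (analyticLogv T.F)).StarPacket v))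
    (frobMmod : ∀ (P : NFPoint) (l : ℕ) (T : Cor22.ThetaVolumeDatumAt P l), letI := T.instFieldF; letI := T.instNumberFieldF;
      ℤ → ℤ → ∀ j : (thetaIndex (X P l T)).LabelStar, Set ((logShellsDH (X P l T) (analyticLogv T.F)).GlobalPacket j.1))
    (unitImage : ∀ (P : NFPoint) (l : ℕ) (T : Cor22.ThetaVolumeDatumAt P l), letI := T.instFieldF; letI := T.instNumberFieldF;
      ℤ → ℤ → ℕ → ∀ (j : (thetaIndex (X P l T)).Label) (vQ : (thetaIndex (X P l T)).VQ), Set ((logShellsDH (X P l T) (analyticLogv T.F)).Packet j vQ))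
    (ballImage : ∀ (P : NFPoint) (l : ℕ) (T : Cor22.ThetaVolumeDatumAt P l), letI := T.instFieldF; letI := T.instNumberFieldF;
      ℤ → ℤ → ∀ (j : (thetaIndex (X P l T)).Label) (vQ : (thetaIndex (X P l T)).VQ), Set ((logShellsDH (X P l T) (analyticLogv T.F)).Packet j vQ))
    (thetaDiv : ∀ (P : NFPoint) (l : ℕ) (T : Cor22.ThetaVolumeDatumAt P l), letI := T.instFieldF; letI := T.instNumberFieldF;
      ℤ → ℤ → LgpDivisor (M P l T) (thetaIndex (X P l T)).lstar)
    (n : ∀ (P : NFPoint) (l : ℕ) (T : Cor22.ThetaVolumeDatumAt P l), ℤ)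
    {HT : ∀ (P : NFPoint) (l : ℕ) (T : Cor22.ThetaVolumeDatumAt P l), Type} {LogLink : ∀ (P : NFPoint) (l : ℕ) (T : Cor22.ThetaVolumeDatumAt P l), HT P l T → HT P l T → Type}
    {IsFull : ∀ (P : NFPoint) (l : ℕ) (T : Cor22.ThetaVolumeDatumAt P l), ∀ {s t : HT P l T}, LogLink P l T s t → Prop}
    (lat : ∀ (P : NFPoint) (l : ℕ) (T : Cor22.ThetaVolumeDatumAt P l), LGPGaussianLogThetaLattice (LogLink P l T) (IsFull P l T))
    {Frd : ∀ (P : NFPoint) (l : ℕ) (T : Cor22.ThetaVolumeDatumAt P l), Type} {IsoF : ∀ (P : NFPoint) (l : ℕ) (T : Cor22.ThetaVolumeDatumAt P l), Frd P l T → Frd P l T → Type} {Ob : ∀ (P : NFPoint) (l : ℕ) (T : Cor22.ThetaVolumeDatumAt P l), Frd P l T → Type}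
    {realify : ∀ (P : NFPoint) (l : ℕ) (T : Cor22.ThetaVolumeDatumAt P l), Frd P l T → Frd P l T} {Strip : ∀ (P : NFPoint) (l : ℕ) (T : Cor22.ThetaVolumeDatumAt P l), Type} {IsoS : ∀ (P : NFPoint) (l : ℕ) (T : Cor22.ThetaVolumeDatumAt P l), Strip P l T → Strip P l T → Type}
    {Mv : ∀ (P : NFPoint) (l : ℕ) (T : Cor22.ThetaVolumeDatumAt P l), letI := T.instFieldF; letI := T.instNumberFieldF;
      ∀ v : (thetaIndex (X P l T)).V, v ∈ (thetaIndex (X P l T)).Vbad → Type}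
    [∀ P l T v h, Monoid (Mv P l T v h)]
    (sig : ∀ (P : NFPoint) (l : ℕ) (T : Cor22.ThetaVolumeDatumAt P l), letI := T.instFieldF; letI := T.instNumberFieldF;
      GlobalLGPFrobenioidSignature (thetaIndex (X P l T)).lstar (thetaIndex (X P l T)).V (· ∈ (thetaIndex (X P l T)).Vbad) (Frd P l T) (IsoF P l T) (Ob P l T) (realify P l T)
        (Strip P l T) (IsoS P l T) (Mv P l T))
    (split : ∀ (P : NFPoint) (l : ℕ) (T : Cor22.ThetaVolumeDatumAt P l), SplittingMonoids (Mv P l T))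
    {ObΔ : ∀ (P : NFPoint) (l : ℕ) (T : Cor22.ThetaVolumeDatumAt P l), Type} {N : ∀ (P : NFPoint) (l : ℕ) (T : Cor22.ThetaVolumeDatumAt P l), letI := T.instFieldF; letI := T.instNumberFieldF;
      ∀ v : (thetaIndex (X P l T)).V, v ∈ (thetaIndex (X P l T)).Vbad → Type}
    [∀ P l T v h, Monoid (N P l T v h)] (qData : ∀ (P : NFPoint) (l : ℕ) (T : Cor22.ThetaVolumeDatumAt P l), QPilotData (ObΔ P l T) (N P l T))
    (t : ∀ (P : NFPoint) (l : ℕ) (T : Cor22.ThetaVolumeDatumAt P l), letI := T.instFieldF; letI := T.instNumberFieldF;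
      ∀ (pp : Nat.Primes) (_ : Fin (X P l T).lstar) (x : (thetaIndex (X P l T)).Fibre (.inr pp)), haveI : Fact (pp : ℕ).Prime := ⟨pp.2⟩; kOf (X P l T) pp.1 x)
    (tq : ∀ (P : NFPoint) (l : ℕ) (T : Cor22.ThetaVolumeDatumAt P l), letI := T.instFieldF; letI := T.instNumberFieldF;
      ∀ (pp : Nat.Primes) (x : (thetaIndex (X P l T)).Fibre (.inr pp)), haveI : Fact (pp : ℕ).Prime := ⟨pp.2⟩; kOf (X P l T) pp.1 x)
    (ρ : ∀ (P : NFPoint) (l : ℕ) (T : Cor22.ThetaVolumeDatumAt P l), letI := T.instFieldF; letI := T.instNumberFieldF;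
      (∀ v : (thetaIndex (X P l T)).V, v ∈ (thetaIndex (X P l T)).Vbad → Set ((logShellsDH (X P l T) (analyticLogv T.F)).StarPacket v)) → ∀ (j : (thetaIndex (X P l T)).Label) (vQ : (thetaIndex (X P l T)).VQ), Set ((logShellsDH (X P l T) (analyticLogv T.F)).Packet j vQ))
    (qK : ∀ (P : NFPoint) (l : ℕ) (T : Cor22.ThetaVolumeDatumAt P l), letI := T.instFieldF; letI := T.instNumberFieldF;
      ∀ v : (thetaIndex (X P l T)).V, v ∈ (thetaIndex (X P l T)).Vbad → Set ((logShellsDH (X P l T) (analyticLogv T.F)).StarPacket v))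
    -- [SIDE] `X` is the pilot data OF `T.D`; the ideles are non-zero, units off `S`; the q-ideles REALISE `P_q`
    (hX : ∀ (P : NFPoint) (l : ℕ) (T : Cor22.ThetaVolumeDatumAt P l), letI := T.instFieldF; letI := T.instNumberFieldF; letI := T.instAlgebraF; letI := T.instFieldK;
        letI := T.instNumberFieldK; letI := T.instAlgebraK; letI := T.instFieldFbar; letI := T.instAlgebraFbar;
        letI := T.instAlgebraKFbar; letI := T.instIsElliptic;
      Cor312Prov.IsPilotDataOf T.D (X P l T))
    (htq0 : ∀ P l T pp x, tq P l T pp x ≠ 0)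
    (htq1 : ∀ (P : NFPoint) (l : ℕ) (T : Cor22.ThetaVolumeDatumAt P l), letI := T.instFieldF; letI := T.instNumberFieldF;
      ∀ (pp : Nat.Primes) (x : (thetaIndex (X P l T)).Fibre (.inr pp)),
        haveI : Fact (pp : ℕ).Prime := ⟨pp.2⟩; placeOf (X P l T) pp.1 x ∉ (X P l T).S → ‖tq P l T pp x‖ = 1)
    (ht0 : ∀ P l T pp i x, t P l T pp i x ≠ 0)
    (ht1 : ∀ (P : NFPoint) (l : ℕ) (T : Cor22.ThetaVolumeDatumAt P l), letI := T.instFieldF; letI := T.instNumberFieldF;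
      ∀ (pp : Nat.Primes) (i : Fin (X P l T).lstar) (x : (thetaIndex (X P l T)).Fibre (.inr pp)),
        haveI : Fact (pp : ℕ).Prime := ⟨pp.2⟩; placeOf (X P l T) pp.1 x ∉ (X P l T).S → ‖t P l T pp i x‖ = 1)
    (htq : ∀ (P : NFPoint) (l : ℕ) (T : Cor22.ThetaVolumeDatumAt P l), letI := T.instFieldF; letI := T.instNumberFieldF;
      ∀ (pp : Nat.Primes) (x : (thetaIndex (X P l T)).Fibre (.inr pp)),
        haveI : Fact (pp : ℕ).Prime := ⟨pp.2⟩
        Real.log ‖tq P l T pp x‖ = -((X P l T).qPilot (placeOf (X P l T) pp.1 x)) * logNorm T.F (placeOf (X P l T) pp.1 x) /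
          localDegree T.F (placeOf (X P l T) pp.1 x))
    -- [S_H] the HULL-LEVEL form of the printed clause, at every datum, AT THESE DATA
    (hSH : ∀ (P : NFPoint) (l : ℕ) (T : Cor22.ThetaVolumeDatumAt P l), letI := T.instFieldF; letI := T.instNumberFieldF;
      Cor312Vol.PilotKummerCompatHull
        (LatticeSituation.ofShells (logShellsDH (X P l T) (analyticLogv T.F)) (M P l T) (archPk P l T)
          (archSub P l T) (summandPiecesPr (X P l T) (logvAnalytic_analyticLogv (F := T.F))).Adm
          (summandPiecesPr (X P l T) (logvAnalytic_analyticLogv (F := T.F))).logvol (Ψ P l T) (act P l T) (Mmod P l T)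
          (region P l T) (frobAdm P l T) (frobLogvol P l T) (frobΨ P l T) (frobMmod P l T) (unitImage P l T)
          (ballImage P l T) (thetaDiv P l T))
        (settingPrVolSharp (X P l T) (logvAnalytic_analyticLogv (F := T.F)) (M P l T) (archPk P l T) (archSub P l T) (Ψ P l T)
          (act P l T) (Mmod P l T) (region P l T) (n P l T) (lat P l T) (sig P l T) (split P l T) (qData P l T) (tq P l T)
          (t P l T) (htq0 P l T) (htq1 P l T)) (ρ P l T) (qK P l T))
    -- [PIN] the q-pin (pq′) ONLY
    (hQPin : ∀ (P : NFPoint) (l : ℕ) (T : Cor22.ThetaVolumeDatumAt P l), letI := T.instFieldF; letI := T.instNumberFieldF;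
      Cor312Vol.QPinned
        (LatticeSituation.ofShells (logShellsDH (X P l T) (analyticLogv T.F)) (M P l T) (archPk P l T)
          (archSub P l T) (summandPiecesPr (X P l T) (logvAnalytic_analyticLogv (F := T.F))).Adm
          (summandPiecesPr (X P l T) (logvAnalytic_analyticLogv (F := T.F))).logvol (Ψ P l T) (act P l T) (Mmod P l T)
          (region P l T) (frobAdm P l T) (frobLogvol P l T) (frobΨ P l T) (frobMmod P l T) (unitImage P l T)
          (ballImage P l T) (thetaDiv P l T))
        (settingPrVolSharp (X P l T) (logvAnalytic_analyticLogv (F := T.F)) (M P l T) (archPk P l T) (archSub P l T) (Ψ P l T)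
          (act P l T) (Mmod P l T) (region P l T) (n P l T) (lat P l T) (sig P l T) (split P l T) (qData P l T) (tq P l T)
          (t P l T) (htq0 P l T) (htq1 P l T)) (ρ P l T) (qK P l T))
    -- [FACT] (none) · [CONE] the hull-volume estimate with `B_III` for the NON-slot-constant data ONLY (c312-8 p428563's `hreg`, verbatim)
    (hreg : ∀ P : NFPoint, P ∈ UP → ∀ l : ℕ, l.Prime → 5 ≤ l →
      Cor22.AdmitsCore P → Cor22.CondP2 P l → Cor22.CondP5 P l → Cor22.CondP6 P l →
      ∀ T : Cor22.ThetaVolumeDatumAt P l,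
        (letI := T.instFieldF; letI := T.instNumberFieldF; letI := T.instAlgebraF; letI := T.instFieldK
         letI := T.instNumberFieldK; letI := T.instAlgebraK; letI := T.instFieldFbar; letI := T.instAlgebraFbar
         letI := T.instAlgebraKFbar; letI := T.instIsElliptic
         ¬ (∀ p ∈ T.I.supportPrimes, ∀ v w : placesOver (fieldOfModuli T.E) p,
            (Summit.ABC.IUTFork.DHData.ofInput T.I).logQloc p v = (Summit.ABC.IUTFork.DHData.ofInput T.I).logQloc p w)) →
        T.HullEstimateOf
          (((l : ℝ) + 1) / 4 *
            ((1 + 12 * (Cor22.dmod P : ℝ) / l) * (P.logDiff + Cor22.logCondAvoid P {2, l})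
              + 2 * Real.log l + 52
              + 20 / 3 * Real.log (((2 ^ 12 * 3 ^ 3 * 5 * Cor22.dmod P : ℕ) : ℝ) * (l : ℝ))
                * (Nat.primeCounting (2 ^ 12 * 3 ^ 3 * 5 * Cor22.dmod P * l) : ℝ))))
    -- [READ] the ONE-SIDED Θ-side identification: the genuine setting's verbatim `−|log(Θ)|` ≤ the datum's defined one
    (hΘ : ∀ (P : NFPoint) (l : ℕ) (T : Cor22.ThetaVolumeDatumAt P l), letI := T.instFieldF; letI := T.instNumberFieldF;
      (settingPrVolSharp (X P l T) (logvAnalytic_analyticLogv (F := T.F)) (M P l T) (archPk P l T) (archSub P l T) (Ψ P l T)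
          (act P l T) (Mmod P l T) (region P l T) (n P l T) (lat P l T) (sig P l T) (split P l T) (qData P l T) (tq P l T)
          (t P l T) (htq0 P l T) (htq1 P l T)).negLogTheta ≤
        ((T.negLogTheta : ℝ) : WithTop ℝ)) :
    _root_.ABC := by
  -- Step 1–2: [IUTchIII] Cor 3.12 at EVERY genuine Θ-volume datum on the HULL-LEVEL line, AT ITS GENUINE REAL SETTING (§1 under `T`'s instances)
  have h312 : ∀ (P : NFPoint) (l : ℕ), Cor22.Cor312AtDatum P l := fun P l T => by
    letI := T.instFieldF; letI := T.instNumberFieldF; letI := T.instAlgebraF; letI := T.instFieldK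
    letI := T.instNumberFieldK; letI := T.instAlgebraK; letI := T.instFieldFbar; letI := T.instAlgebraFbar
    letI := T.instAlgebraKFbar; letI := T.instIsElliptic
    exact Shrink3.cor312Of_of_SH T.D (X P l T) (M P l T) (archPk P l T) (archSub P l T) (Ψ P l T) (act P l T) (Mmod P l T)
      (region P l T) (frobAdm P l T) (frobLogvol P l T) (frobΨ P l T) (frobMmod P l T) (unitImage P l T) (ballImage P l T)
      (thetaDiv P l T) (n P l T) (lat P l T) (sig P l T) (split P l T) (qData P l T) (t P l T) (tq P l T) (ρ P l T) (qK P l T)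
      T.isVolumeInputOf (hX P l T) (htq0 P l T) (htq1 P l T) (ht0 P l T) (ht1 P l T) (htq P l T) (hSH P l T) (hQPin P l T)
      (hΘ P l T)
  -- Step 3: the (U)-line capstone — slot-constant data PROVED inside, GenEllTwo discharged by name (c312-8 p428563)
  exact ThetaPartII.ABC_of_cor312_of_hullRegime (fun P _ l _ _ _ _ _ _ => h312 P l) hreg

end Family

end Summit.ABC.IUTFork.Conditional

end
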